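import Mathlib.LinearAlgebra.Matrix.ToLin
import Mathlib.LinearAlgebra.Quotient.Basic
import Mathlib.LinearAlgebra.FiniteDimensional.Basic
import Mathlib.LinearAlgebra.Basis.VectorSpace
import Literature.NumberTheory.Automorphic.AlgebraicHomImages
import Literature.NumberTheory.Automorphic.UnipotentSolvable
import HarnessLib

/-!
# The representations of a stabiliser `Stab_G(W)` on `W` and on `kⁿ / W`

`k`-points vocabulary of `LinearAlgebraicGroups.lean` (algebraic groups are subgroups of
`GL n k`; algebraic homomorphisms `MonoidHom.IsAlgebraicGL`; `glLin g` the linear map of `g`,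
`UnipotentSolvable.lean`), generalising `LineQuotient.lean`
(the case of a line `W = k v`) to an arbitrary subspace `W ≤ kⁿ` (Springer, *Linear Algebraic
Groups*, 2nd ed., 2.3.1–2.3.2: a rational representation restricts to invariant subspaces and
passes to quotients):

* `stabSubmodule W ≤ GL n k` — the stabiliser `{g | g W ⊆ W}`, an algebraic subgroup
  (`isAlgebraicSubgroup_stabSubmodule`);
* `subRep W : Stab(W) → GL_d(k)` (`d = dim W`) — the matrix of `g|_W` in a fixed basis of `W`,
  and `quotRep W : Stab(W) → GL_{n-d}(k)` — the matrix of the map induced on `kⁿ / W`; both are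
  algebraic (`isAlgebraicGL_subRep`, `isAlgebraicGL_quotRep`);
* the common kernel consists of unipotent elements (`isUnipotentElt_of_subRep_eq_one`:
  `(g - 1)² = 0`) and is commutative (`mul_comm_of_subRep_eq_one`), hence solvable.

Used for inductions on `n` through a `G`-stable subspace (`NilpotentBorel.lean`).

## References

* T. A. Springer, *Linear Algebraic Groups*, 2nd ed., Progress in Mathematics 9, Birkhäuser
  (1998), 2.3.1–2.3.2 [SpringerLAG1998].
-/

noncomputable section

open Matrix MvPolynomial

namespace Literature.NumberTheory.Automorphic

variable {k : Type*} [Field k] {ι : Type*} [Fintype ι] [DecidableEq ι]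

/-! ### The stabiliser of a subspace -/

section Stab

variable (W : Submodule k (ι → k))

/-- `glLin g v = g v` (`glLin` of `UnipotentSolvable.lean`: the linear map of `g ∈ GL n k`). [folklore] -/
@[simp] lemma glLin_apply (g : GL ι k) (v : ι → k) : glLin g v = (g : Matrix ι ι k) *ᵥ v :=
  Matrix.toLin'_apply _ _

/-- The **stabiliser of a subspace** `W ≤ kⁿ` in `GL n k`: `{g | g W ⊆ W}` (then `g W = W` and
`g⁻¹ W = W` by dimension; Springer 2.3.1). [folklore] -/
def stabSubmodule : Subgroup (GL ι k) where
  carrier := {g | ∀ v ∈ W, (g : Matrix ι ι k) *ᵥ v ∈ W}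
  mul_mem' := fun {g h} hg hh v hv => by
    rw [Units.val_mul, ← Matrix.mulVec_mulVec]
    exact hg _ (hh v hv)
  one_mem' := fun v hv => by simpa using hv
  inv_mem' := fun {g} hg v hv => by
    -- `g|_W` is injective, hence surjective
    let f : ↥W →ₗ[k] ↥W := (glLin g).restrict fun w hw => by simpa using hg w hw
    have hinj : Function.Injective f := by
      intro x y hxy
      apply Subtype.ext
      have h1 : (glLin g) x = (glLin g) y := congrArg Subtype.val hxy
      simpa [Matrix.mulVec_mulVec] using congrArg (fun z => ((g⁻¹ : GL ι k) : Matrix ι ι k) *ᵥ z) h1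
    obtain ⟨w, hw⟩ := (LinearMap.injective_iff_surjective.1 hinj) ⟨v, hv⟩
    have hw' : (g : Matrix ι ι k) *ᵥ (w : ι → k) = v := by
      have := congrArg Subtype.val hw
      simpa [f] using this
    rw [← hw', Matrix.mulVec_mulVec, ← Units.val_mul, inv_mul_cancel, Units.val_one, Matrix.one_mulVec]
    exact w.2

variable {W}

/-- Membership in the stabiliser. [folklore] -/
lemma mem_stabSubmodule_iff {g : GL ι k} : g ∈ stabSubmodule W ↔ ∀ v ∈ W, (g : Matrix ι ι k) *ᵥ v ∈ W :=
  Iff.rfl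

/-- The restriction hypothesis for `LinearMap.restrict`. [folklore] -/
lemma mapsTo_of_mem_stabSubmodule {g : GL ι k} (hg : g ∈ stabSubmodule W) :
    ∀ v ∈ W, glLin g v ∈ W := fun v hv => by simpa using hg v hv

/-- The comap hypothesis for `Submodule.mapQ`. [folklore] -/
lemma le_comap_of_mem_stabSubmodule {g : GL ι k} (hg : g ∈ stabSubmodule W) : W ≤ W.comap (glLin g) :=
  fun v hv => mapsTo_of_mem_stabSubmodule hg v hv

variable (W)

/-- **The stabiliser of a subspace is algebraic**: `g W ⊆ W` means that the (finitely many)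
linear functionals `ψᵢ ∘ (kⁿ → kⁿ/W)` vanish on the `g wⱼ` for a basis `(wⱼ)` of `W` and a
basis `(ψᵢ)` of coordinates of `kⁿ/W` — linear equations in the entries of `g`
(Springer 2.3.1). [folklore] -/
theorem isAlgebraicSubgroup_stabSubmodule : IsAlgebraicSubgroup (stabSubmodule W) := by
  classical
  set bW := Module.finBasis k ↥W with hbW
  set bQ := Module.finBasis k ((ι → k) ⧸ W) with hbQ
  -- the functionals `ψ i = (coord i) ∘ mkQ` on `kⁿ`
  let ψ : Fin (Module.finrank k ((ι → k) ⧸ W)) → (ι → k) →ₗ[k] k := fun i => (bQ.coord i) ∘ₗ W.mkQ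
  have hψ : ∀ v : ι → k, v ∈ W ↔ ∀ i, ψ i v = 0 := by
    intro v
    rw [← Submodule.Quotient.mk_eq_zero W, ← bQ.forall_coord_eq_zero_iff]
    rfl
  -- the equations
  refine ⟨Set.range fun ij : Fin (Module.finrank k ((ι → k) ⧸ W)) × Fin (Module.finrank k ↥W) =>
    ∑ m, ∑ l, MvPolynomial.C (ψ ij.1 (Pi.single m 1) * ((bW ij.2 : ↥W) : ι → k) l) *
      MvPolynomial.X (Sum.inl (m, l)), Set.ext fun g => ?_⟩
  have hlin : ∀ (i : Fin (Module.finrank k ((ι → k) ⧸ W))) (v : ι → k),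
      ψ i v = ∑ m, ψ i (Pi.single m 1) * v m := by
    intro i v
    conv_lhs => rw [show v = ∑ m, v m • (Pi.single m 1 : ι → k) from by
      ext j; simp [Finset.sum_apply, Pi.single_apply]]
    rw [map_sum]
    refine Finset.sum_congr rfl fun m _ => ?_
    rw [map_smul, smul_eq_mul, mul_comm]
  simp only [SetLike.mem_coe, zeroLocusGL, Set.mem_setOf_eq, Set.forall_mem_range, map_sum, map_mul,
    MvPolynomial.eval_C, MvPolynomial.eval_X, glCoordFun_inl]
  constructor
  · intro hg ⟨i, j⟩
    have h1 := (hψ _).1 (hg _ (bW j).2) i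
    rw [hlin] at h1
    simp only [Matrix.mulVec, dotProduct, Finset.mul_sum] at h1
    rw [← h1]
    refine Finset.sum_congr rfl fun m _ => Finset.sum_congr rfl fun l _ => by ring
  · intro h v hv
    -- the basis vectors `bW j` are mapped into `W` …
    have hbasis : ∀ j, (g : Matrix ι ι k) *ᵥ ((bW j : ↥W) : ι → k) ∈ W := by
      intro j
      rw [hψ]
      intro i
      rw [hlin]
      simp only [Matrix.mulVec, dotProduct, Finset.mul_sum]
      rw [← h ⟨i, j⟩]
      refine Finset.sum_congr rfl fun m _ => Finset.sum_congr rfl fun l _ => by ring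
    -- … hence so is every `v ∈ W`
    have hsum : v = ∑ j, (bW.repr ⟨v, hv⟩ j) • ((bW j : ↥W) : ι → k) := by
      have h1 := congrArg Subtype.val (bW.sum_repr ⟨v, hv⟩)
      simp only [Submodule.coe_sum, Submodule.coe_smul] at h1
      exact h1.symm
    rw [hsum, Matrix.mulVec_sum]
    refine Submodule.sum_mem _ fun j _ => ?_
    rw [Matrix.mulVec_smul]
    exact Submodule.smul_mem _ _ (hbasis j)

end Stab

/-! ### The representations on `W` and on `kⁿ / W` -/

section Reps

variable (W : Submodule k (ι → k))

/-- A fixed basis of `W`. [folklore] -/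
def basisSub : Module.Basis (Fin (Module.finrank k ↥W)) k ↥W := Module.finBasis k ↥W

/-- A fixed basis of `kⁿ / W`. [folklore] -/
def basisQuot : Module.Basis (Fin (Module.finrank k ((ι → k) ⧸ W))) k ((ι → k) ⧸ W) :=
  Module.finBasis k _

/-- The restriction of `g ∈ Stab(W)` to `W`, as a linear endomorphism of `W`. [folklore] -/
def subLin (g : ↥(stabSubmodule W)) : ↥W →ₗ[k] ↥W :=
  (glLin (g : GL ι k)).restrict (mapsTo_of_mem_stabSubmodule g.2)

/-- The map induced by `g ∈ Stab(W)` on `kⁿ / W`. [folklore] -/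
def quotLin (g : ↥(stabSubmodule W)) : ((ι → k) ⧸ W) →ₗ[k] ((ι → k) ⧸ W) :=
  W.mapQ W (glLin (g : GL ι k)) (le_comap_of_mem_stabSubmodule g.2)

/-- `subLin` is multiplicative. [folklore] -/
lemma subLin_mul (g h : ↥(stabSubmodule W)) : subLin W (g * h) = subLin W g ∘ₗ subLin W h := by
  apply LinearMap.ext
  intro w
  apply Subtype.ext
  simp [subLin, LinearMap.restrict_apply, Matrix.mulVec_mulVec]

/-- `subLin 1 = id`. [folklore] -/
lemma subLin_one : subLin W 1 = LinearMap.id := by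
  apply LinearMap.ext
  intro w
  apply Subtype.ext
  simp [subLin, LinearMap.restrict_apply]

/-- `quotLin` is multiplicative. [folklore] -/
lemma quotLin_mul (g h : ↥(stabSubmodule W)) : quotLin W (g * h) = quotLin W g ∘ₗ quotLin W h := by
  apply LinearMap.ext
  intro x
  obtain ⟨v, rfl⟩ := W.mkQ_surjective x
  simp [quotLin, Submodule.mapQ_apply, Matrix.mulVec_mulVec]

/-- `quotLin 1 = id`. [folklore] -/
lemma quotLin_one : quotLin W 1 = LinearMap.id := by
  apply LinearMap.ext
  intro x
  obtain ⟨v, rfl⟩ := W.mkQ_surjective x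
  simp [quotLin, Submodule.mapQ_apply]

/-- **The representation of `Stab(W)` on `W`**: the matrix of `g|_W` in the basis `basisSub W`
(Springer 2.3.1–2.3.2). [folklore] -/
def subRep : ↥(stabSubmodule W) →* GL (Fin (Module.finrank k ↥W)) k :=
  MonoidHom.toHomUnits
    { toFun := fun g => LinearMap.toMatrix (basisSub W) (basisSub W) (subLin W g)
      map_one' := by simp [subLin_one]
      map_mul' := fun g h => by
        simp [subLin_mul, LinearMap.toMatrix_comp (basisSub W) (basisSub W) (basisSub W)] }

/-- **The representation of `Stab(W)` on `kⁿ / W`**: the matrix of the induced map in the basis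
`basisQuot W` (Springer 2.3.1–2.3.2). [folklore] -/
def quotRep : ↥(stabSubmodule W) →* GL (Fin (Module.finrank k ((ι → k) ⧸ W))) k :=
  MonoidHom.toHomUnits
    { toFun := fun g => LinearMap.toMatrix (basisQuot W) (basisQuot W) (quotLin W g)
      map_one' := by simp [quotLin_one]
      map_mul' := fun g h => by
        simp [quotLin_mul, LinearMap.toMatrix_comp (basisQuot W) (basisQuot W) (basisQuot W)] }

/-- The matrix of `subRep g`. [folklore] -/
@[simp] lemma coe_subRep (g : ↥(stabSubmodule W)) :
    ((subRep W g : GL _ k) : Matrix _ _ k) = LinearMap.toMatrix (basisSub W) (basisSub W) (subLin W g) :=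
  rfl

/-- The matrix of `quotRep g`. [folklore] -/
@[simp] lemma coe_quotRep (g : ↥(stabSubmodule W)) :
    ((quotRep W g : GL _ k) : Matrix _ _ k) =
      LinearMap.toMatrix (basisQuot W) (basisQuot W) (quotLin W g) :=
  rfl

/-- The entries of `subRep g`: `wᵢ^* (g wⱼ)`. [folklore] -/
lemma subRep_apply (g : ↥(stabSubmodule W)) (i j : Fin (Module.finrank k ↥W)) :
    ((subRep W g : GL _ k) : Matrix _ _ k) i j =
      (basisSub W).repr ⟨((g : GL ι k) : Matrix ι ι k) *ᵥ ((basisSub W j : ↥W) : ι → k),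
        g.2 _ (basisSub W j).2⟩ i := by
  rw [coe_subRep, LinearMap.toMatrix_apply]
  congr 2

/-- The entries of `quotRep g`: `ψᵢ (g qⱼ)` for lifts `qⱼ` of the basis of the quotient.
[folklore] -/
lemma quotRep_apply (g : ↥(stabSubmodule W)) (i j : Fin (Module.finrank k ((ι → k) ⧸ W)))
    (q : ι → k) (hq : W.mkQ q = basisQuot W j) :
    ((quotRep W g : GL _ k) : Matrix _ _ k) i j =
      (basisQuot W).repr (W.mkQ (((g : GL ι k) : Matrix ι ι k) *ᵥ q)) i := by
  rw [coe_quotRep, LinearMap.toMatrix_apply, ← hq]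
  simp [quotLin, Submodule.mapQ_apply]

end Reps

/-! ### Algebraicity -/

section Algebraic

variable (W : Submodule k (ι → k))

/-- A linear functional on `kⁿ` is the linear polynomial `∑ₘ φ(eₘ) xₘ`. [folklore] -/
lemma linearForm_apply_eq_sum (φ : (ι → k) →ₗ[k] k) (v : ι → k) :
    φ v = ∑ m, φ (Pi.single m 1) * v m := by
  conv_lhs => rw [show v = ∑ m, v m • (Pi.single m 1 : ι → k) from by
    ext j; simp [Finset.sum_apply, Pi.single_apply]]
  rw [map_sum]
  refine Finset.sum_congr rfl fun m _ => ?_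
  rw [map_smul, smul_eq_mul, mul_comm]

/-- The polynomial `∑ₘ ∑ₗ φ(eₘ) w_l x_{m l}` computing `φ (g w)`. [folklore] -/
def linFormPoly (φ : (ι → k) →ₗ[k] k) (w : ι → k) : MvPolynomial (GLCoord ι) k :=
  ∑ m, ∑ l, MvPolynomial.C (φ (Pi.single m 1) * w l) * MvPolynomial.X (Sum.inl (m, l))

/-- `linFormPoly φ w` evaluates to `φ (g w)`. [folklore] -/
lemma eval_linFormPoly (φ : (ι → k) →ₗ[k] k) (w : ι → k) (g : GL ι k) :
    MvPolynomial.eval (glCoordFun g) (linFormPoly φ w) = φ ((g : Matrix ι ι k) *ᵥ w) := by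
  rw [linearForm_apply_eq_sum]
  simp only [linFormPoly, map_sum, map_mul, MvPolynomial.eval_C, MvPolynomial.eval_X, glCoordFun_inl,
    Matrix.mulVec, dotProduct, Finset.mul_sum]
  refine Finset.sum_congr rfl fun m _ => Finset.sum_congr rfl fun l _ => by ring

/-- The `det⁻¹` coordinate of a representation whose entries are polynomials `E i j` in the
coordinates: `(det ρ(g))⁻¹ = det ρ(g⁻¹)` is the determinant of the `E i j` composed with the
inversion polynomials. [folklore] -/
lemma isAlgebraicGL_of_entries {G : Subgroup (GL ι k)} {d : ℕ} (ρ : ↥G →* GL (Fin d) k)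
    (E : Fin d → Fin d → MvPolynomial (GLCoord ι) k)
    (hE : ∀ (g : ↥G) (i j : Fin d), ((ρ g : GL (Fin d) k) : Matrix (Fin d) (Fin d) k) i j =
      MvPolynomial.eval (glCoordFun (g : GL ι k)) (E i j)) :
    MonoidHom.IsAlgebraicGL ρ := by
  classical
  refine ⟨Sum.elim (fun ij => E ij.1 ij.2)
    (fun _ => Matrix.det (Matrix.of fun i j => MvPolynomial.bind₁ invPolyGL (E i j))), fun g c => ?_⟩
  rcases c with ⟨i, j⟩ | u
  · rw [glCoordFun_inl, Sum.elim_inl, hE]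
  · rw [glCoordFun_inr, Sum.elim_inr, RingHom.map_det, RingHom.mapMatrix_apply]
    have h1 : (Matrix.det ((ρ g : GL (Fin d) k) : Matrix (Fin d) (Fin d) k))⁻¹ =
        Matrix.det ((ρ g⁻¹ : GL (Fin d) k) : Matrix (Fin d) (Fin d) k) := by
      rw [map_inv, Matrix.coe_units_inv, Matrix.det_nonsing_inv, Ring.inverse_eq_inv']
    rw [h1]
    congr 1
    ext i j
    rw [Matrix.map_apply, Matrix.of_apply, hE, eval_bind₁]
    have hc : (fun c => MvPolynomial.eval (glCoordFun (g : GL ι k)) (invPolyGL c)) =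
        glCoordFun ((g⁻¹ : ↥G) : GL ι k) := by
      funext c
      rw [eval_invPolyGL]
      rfl
    rw [hc]

/-- **`subRep W` is an algebraic homomorphism**: its entries are `wᵢ^*(g wⱼ)` for linear
extensions `wᵢ^*` to `kⁿ` of the coordinate functionals of the basis of `W`
(Springer 2.3.2). [folklore] -/
theorem isAlgebraicGL_subRep : MonoidHom.IsAlgebraicGL (subRep W) := by
  classical
  choose Φ hΦ using fun i => LinearMap.exists_extend ((basisSub W).coord i)
  refine isAlgebraicGL_of_entries (subRep W)
    (fun i j => linFormPoly (Φ i) ((basisSub W j : ↥W) : ι → k)) fun g i j => ?_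
  rw [eval_linFormPoly, subRep_apply]
  have h1 := LinearMap.congr_fun (hΦ i) ⟨((g : GL ι k) : Matrix ι ι k) *ᵥ ((basisSub W j : ↥W) : ι → k),
    g.2 _ (basisSub W j).2⟩
  simp only [LinearMap.coe_comp, Function.comp_apply, Submodule.coe_subtype, Module.Basis.coord_apply] at h1
  exact h1.symm

/-- **`quotRep W` is an algebraic homomorphism**: its entries are `ψᵢ (g qⱼ)` for the coordinate
functionals `ψᵢ` of the basis of `kⁿ/W` pulled back to `kⁿ` and lifts `qⱼ` of the basis vectors
(Springer 2.3.2). [folklore] -/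
theorem isAlgebraicGL_quotRep : MonoidHom.IsAlgebraicGL (quotRep W) := by
  classical
  choose q hq using fun j => W.mkQ_surjective (basisQuot W j)
  refine isAlgebraicGL_of_entries (quotRep W)
    (fun i j => linFormPoly (((basisQuot W).coord i) ∘ₗ W.mkQ) (q j)) fun g i j => ?_
  rw [eval_linFormPoly, quotRep_apply W g i j (q j) (hq j)]
  rfl

end Algebraic

/-! ### The common kernel is unipotent and commutative -/

section Kernel

variable (W : Submodule k (ι → k))

/-- If `g` acts trivially on `W` then `g w = w` for `w ∈ W`. [folklore] -/
lemma mulVec_eq_self_of_subRep_eq_one {g : ↥(stabSubmodule W)} (h : subRep W g = 1) {w : ι → k}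
    (hw : w ∈ W) : ((g : GL ι k) : Matrix ι ι k) *ᵥ w = w := by
  have h1 : subLin W g = LinearMap.id := by
    apply (LinearMap.toMatrix (basisSub W) (basisSub W)).injective
    rw [LinearMap.toMatrix_id, ← coe_subRep, h, Units.val_one]
  have h2 := LinearMap.congr_fun h1 ⟨w, hw⟩
  have h3 := congrArg Subtype.val h2
  simpa [subLin, LinearMap.restrict_apply] using h3

/-- If `g` acts trivially on `kⁿ / W` then `g v - v ∈ W`. [folklore] -/
lemma mulVec_sub_self_mem_of_quotRep_eq_one {g : ↥(stabSubmodule W)} (h : quotRep W g = 1) (v : ι → k) :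
    ((g : GL ι k) : Matrix ι ι k) *ᵥ v - v ∈ W := by
  have h1 : quotLin W g = LinearMap.id := by
    apply (LinearMap.toMatrix (basisQuot W) (basisQuot W)).injective
    rw [LinearMap.toMatrix_id, ← coe_quotRep, h, Units.val_one]
  have h2 := LinearMap.congr_fun h1 (W.mkQ v)
  simp only [quotLin, LinearMap.id_coe, id_eq] at h2
  rw [Submodule.mkQ_apply, Submodule.mapQ_apply, glLin_apply] at h2
  exact (Submodule.Quotient.eq W).1 h2

/-- **The common kernel of `subRep` and `quotRep` is unipotent**: if `g` acts trivially on `W`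
and on `kⁿ / W` then `(g - 1)² = 0` (Springer 2.4: `g` is unipotent). [folklore] -/
theorem isUnipotentElt_of_subRep_eq_one {g : ↥(stabSubmodule W)} (h₁ : subRep W g = 1)
    (h₂ : quotRep W g = 1) : IsUnipotentElt ((g : ↥(stabSubmodule W)) : GL ι k) := by
  refine ⟨2, ?_⟩
  have key : ∀ v : ι → k, (((g : GL ι k) : Matrix ι ι k) - 1) *ᵥ ((((g : GL ι k) : Matrix ι ι k) - 1) *ᵥ v) = 0 := by
    intro v
    have hv : (((g : GL ι k) : Matrix ι ι k) - 1) *ᵥ v ∈ W := by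
      rw [Matrix.sub_mulVec, Matrix.one_mulVec]
      exact mulVec_sub_self_mem_of_quotRep_eq_one W h₂ v
    rw [Matrix.sub_mulVec, Matrix.one_mulVec, mulVec_eq_self_of_subRep_eq_one W h₁ hv, sub_self]
  rw [pow_two]
  refine Matrix.toLin'.injective (LinearMap.ext fun v => ?_)
  rw [Matrix.toLin'_mul, LinearMap.comp_apply, Matrix.toLin'_apply, Matrix.toLin'_apply, key,
    map_zero, LinearMap.zero_apply]

/-- **The common kernel of `subRep` and `quotRep` is commutative**: for `g, h` acting trivially on
`W` and on `kⁿ / W`, `(g - 1)(h - 1) = 0`, so `g h = g + h - 1 = h g`. [folklore] -/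
theorem mul_comm_of_subRep_eq_one {g h : ↥(stabSubmodule W)} (hg₁ : subRep W g = 1) (hg₂ : quotRep W g = 1)
    (hh₁ : subRep W h = 1) (hh₂ : quotRep W h = 1) :
    (g : GL ι k) * (h : GL ι k) = (h : GL ι k) * (g : GL ι k) := by
  have key : ∀ {a b : ↥(stabSubmodule W)}, subRep W a = 1 → quotRep W b = 1 →
      ∀ v, (((a : GL ι k) : Matrix ι ι k) - 1) *ᵥ ((((b : GL ι k) : Matrix ι ι k) - 1) *ᵥ v) = 0 := by
    intro a b ha hb v
    have hv : (((b : GL ι k) : Matrix ι ι k) - 1) *ᵥ v ∈ W := by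
      rw [Matrix.sub_mulVec, Matrix.one_mulVec]
      exact mulVec_sub_self_mem_of_quotRep_eq_one W hb v
    rw [Matrix.sub_mulVec, Matrix.one_mulVec, mulVec_eq_self_of_subRep_eq_one W ha hv, sub_self]
  have hprod : ∀ {a b : ↥(stabSubmodule W)}, subRep W a = 1 → quotRep W b = 1 →
      (((a : GL ι k) : Matrix ι ι k) - 1) * (((b : GL ι k) : Matrix ι ι k) - 1) = 0 := by
    intro a b ha hb
    refine Matrix.toLin'.injective (LinearMap.ext fun v => ?_)
    rw [Matrix.toLin'_mul, LinearMap.comp_apply, Matrix.toLin'_apply, Matrix.toLin'_apply, key ha hb,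
      map_zero, LinearMap.zero_apply]
  apply Units.ext
  rw [Units.val_mul, Units.val_mul]
  have e1 := hprod hg₁ hh₂
  have e2 := hprod hh₁ hg₂
  rw [sub_mul, mul_sub, mul_sub, mul_one, one_mul, one_mul, sub_eq_zero] at e1 e2
  -- `g h - g - (h - 1) = 0` i.e. `g h = g + h - 1`, and symmetrically
  have e1' : ((g : GL ι k) : Matrix ι ι k) * ((h : GL ι k) : Matrix ι ι k) =
      ((g : GL ι k) : Matrix ι ι k) + ((h : GL ι k) : Matrix ι ι k) - 1 := by
    rw [sub_eq_iff_eq_add] at e1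
    rw [e1]; abel
  have e2' : ((h : GL ι k) : Matrix ι ι k) * ((g : GL ι k) : Matrix ι ι k) =
      ((h : GL ι k) : Matrix ι ι k) + ((g : GL ι k) : Matrix ι ι k) - 1 := by
    rw [sub_eq_iff_eq_add] at e2
    rw [e2]; abel
  rw [e1', e2']
  abel

end Kernel

end Literature.NumberTheory.Automorphic
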